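import Literature.NumberTheory.EllipticCurves.SupersingularDensity
import Literature.NumberTheory.EllipticCurves.OrdinaryPrimesProofs
import HarnessLib

/-!
# Infinitely many good ordinary primes — discharge of `WeierstrassCurve.infinite_goodOrdinaryPrimes`

Proof file for the named fact `WeierstrassCurve.infinite_goodOrdinaryPrimes` stated in
`Literature.NumberTheory.EllipticCurves.SupersingularDensity` (kept in a sibling file so that the
statement file keeps its light imports): **every elliptic curve over `ℚ`, given by a globally
minimal Weierstrass equation `W`, has infinitely many primes `p` of good reduction with
`p ∤ a_p(W)`** (good ordinary primes).

The cited source (Serre 1981, §8.2, Théorème 20 and Corollaire 2, p. 189: for `E/ℚ` without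
complex multiplication `#{p ≤ x : a_p = 0} = O(x/(log x)^{3/2-δ})`, so the supersingular primes have
density `0`; Deuring 1941 for CM curves, density `1/2`) proves far more than the vendored
statement and rests on the Chebotarev density theorem, which is beyond Mathlib. The vendored
statement itself has an **elementary proof**, uniform in the CM / non-CM dichotomy, and that is
what is formalised here; it is the proof of `WeierstrassCurve.exists_good_ordinary_prime_holds`
(`OrdinaryPrimesProofs`) run with an arbitrary lower bound:

1. Let `M/ℤ` be the integral model of `W` (`Δ_M ≠ 0`) and `c = 4X³ + b₂X² + 2b₄X + b₆ ∈ ℤ[X]` its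
   2-torsion cubic. By the "poor man's Chebotarev theorem"
   (`Literature.NumberTheory.Sieve.exists_prime_gt_map_int_splits`, an elementary consequence of
   Schur's 1912 theorem on prime divisors of integer polynomials) there are primes `p` beyond any
   given bound — in particular `p > max(n, 4, |Δ_M|)` for every `n` — modulo which `c · (X² + 1)`
   is a product of linear factors over `𝔽_p`.
2. For such `p`: `-1` is a square mod `p`, so `p ≡ 1 (mod 4)`; `c` has three distinct roots in
   `𝔽_p` (`disc c = 16 Δ_M ≢ 0`), so the reduction `Ẽ = M ⊗ 𝔽_p` (an elliptic curve, `p ∤ Δ_M`)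
   has full rational 2-torsion and `4 ∣ N_p = #Ẽ(𝔽_p)` (Lagrange); and `1 ≤ N_p ≤ 2p + 1`
   (each `x` carries at most two points). Hence `p ∣ a_p = p + 1 - N_p` would force
   `N_p ∈ {1, p + 1, 2p + 1} ≡ {1, 2, 3} (mod 4)`, contradicting `4 ∣ N_p`: so `p ∤ a_p`
   (no Hasse bound needed), and `p ∤ Δ_M` gives good reduction at `p`
   (`hasGoodReductionAtPrime_of_not_dvd`).
3. A set of naturals with elements beyond every bound is infinite.

## Contents

All declarations deliberately extend Mathlib's `WeierstrassCurve` namespace (dot notation on `W`),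
as the statement file and `OrdinaryPrimesProofs` do.

* `WeierstrassCurve.mem_goodOrdinaryPrimes_of_splits` — step 2: a prime `p > 4 + |Δ_M|` modulo
  which `c · (X² + 1)` splits is a good ordinary prime of `W`.
* `WeierstrassCurve.infinite_goodOrdinaryPrimes_holds` — the discharge.

## References

* J.-P. Serre, *Quelques applications du théorème de densité de Chebotarev*, Publ. Math. IHÉS 54
  (1981), 123–201, §8.2, Thm. 20 and Cor. 2 (p. 189) — the cited (much stronger) density statement.
* M. Deuring, *Die Typen der Multiplikatorenringe elliptischer Funktionenkörper*, Abh. Math. Sem.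
  Hamburg 14 (1941) — CM case.
* I. Schur, Sitzungsber. Berliner Math. Ges. 11 (1912), 40–50 — prime divisors of polynomials.
* J. H. Silverman, *The Arithmetic of Elliptic Curves*, GTM 106, 2nd ed. (2009), III.2.3 and
  Exercise 3.7 (2-torsion points), VII.1 (minimal equations).
-/

noncomputable section

open scoped Classical
open Polynomial

namespace WeierstrassCurve

/-- **Large split primes are good ordinary.** Let `W/ℚ` be a globally minimal Weierstrass equation
of an elliptic curve, `M` its integral model over `ℤ` and `c = 4X³ + b₂X² + 2b₄X + b₆` the
2-torsion cubic of `M`. If `p > 4 + |Δ_M|` is a prime modulo which `c · (X² + 1)` splits into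
linear factors, then `p` is a prime of good reduction with `p ∤ a_p`: `p ∤ Δ_M` gives good
reduction; `p ≡ 1 (mod 4)` and full rational 2-torsion of the reduction give `4 ∣ N_p`, while
`N_p ≤ 2p + 1`, so `N_p ≢ 1 (mod p)` (Silverman, *AEC* III.2.3, Ex. 3.7, VII.1; the argument of
`exists_good_ordinary_prime_holds` in `OrdinaryPrimesProofs`). [folklore] -/
theorem mem_goodOrdinaryPrimes_of_splits (W : WeierstrassCurve ℚ) [W.IsElliptic]
    [W.IsGloballyMinimal] {p : ℕ} (hp : p.Prime)
    (hNp : 4 + (integralModelInt W).Δ.natAbs < p)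
    (hsplit : (((integralModelInt W).twoTorsionPolynomial.toPoly * (X ^ 2 + 1)).map
      (Int.castRingHom (ZMod p))).Splits) :
    p ∈ W.goodOrdinaryPrimes := by
  set M : WeierstrassCurve ℤ := integralModelInt W with hM
  have hΔ0 : M.Δ ≠ 0 := minimalDiscriminantInt_ne_zero W
  set c : ℤ[X] := M.twoTorsionPolynomial.toPoly with hc
  haveI := Fact.mk hp
  refine ⟨⟨hp⟩, ?_, ?_⟩
  · -- good reduction: `p ∤ Δ_M` since `p > |Δ_M|`
    refine hasGoodReductionAtPrime_of_not_dvd W p fun h => ?_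
    have := Nat.le_of_dvd (Int.natAbs_pos.mpr hΔ0) (Int.ofNat_dvd_left.mp h)
    omega
  · -- ordinarity
    have hp2 : (2 : ZMod p) ≠ 0 := by
      intro h
      have : ((2 : ℕ) : ZMod p) = 0 := by exact_mod_cast h
      rw [ZMod.natCast_eq_zero_iff] at this
      have := Nat.le_of_dvd two_pos this
      omega
    have hpΔ : ((M.Δ : ℤ) : ZMod p) ≠ 0 := by
      intro h
      rw [ZMod.intCast_zmod_eq_zero_iff_dvd] at h
      have := Nat.le_of_dvd (Int.natAbs_pos.mpr hΔ0) (Int.ofNat_dvd_left.mp h)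
      omega
    -- the two factors split modulo `p`
    rw [Polynomial.map_mul] at hsplit
    have hX : ((X ^ 2 + 1 : ℤ[X]).map (Int.castRingHom (ZMod p))) = X ^ 2 + 1 := by
      simp
    have hcp0 : c.map (Int.castRingHom (ZMod p)) ≠ 0 := by
      intro h
      have := congrArg (fun q => q.coeff 3) h
      simp only [hc, coeff_map, Cubic.coeff_eq_a, twoTorsionPolynomial, coeff_zero,
        eq_intCast] at this
      apply hp2
      have h4 : ((4 : ℤ) : ZMod p) = 2 * 2 := by push_cast; norm_num
      rw [h4] at this
      exact (mul_eq_zero.mp this).elim id id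
    have hX0 : ((X ^ 2 + 1 : ℤ[X]).map (Int.castRingHom (ZMod p))) ≠ 0 := by
      rw [hX]; exact (Polynomial.monic_X_pow_add_C 1 two_ne_zero).ne_zero
    have hne : c.map (Int.castRingHom (ZMod p)) *
        (X ^ 2 + 1 : ℤ[X]).map (Int.castRingHom (ZMod p)) ≠ 0 := mul_ne_zero hcp0 hX0
    have hcs : (c.map (Int.castRingHom (ZMod p))).Splits :=
      Splits.of_dvd hsplit hne (dvd_mul_right _ _)
    have hXs : ((X ^ 2 + 1 : ℤ[X]).map (Int.castRingHom (ZMod p))).Splits :=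
      Splits.of_dvd hsplit hne (dvd_mul_left _ _)
    -- `p ≡ 1 (mod 4)`
    have hp4 : p % 4 = 1 := by
      rw [hX] at hXs
      obtain ⟨i, hi⟩ := hXs.exists_eval_eq_zero (by
        rw [← C_1, Polynomial.degree_X_pow_add_C two_pos]; decide)
      simp only [eval_add, eval_pow, eval_X, eval_one] at hi
      have h3 := ZMod.mod_four_ne_three_of_sq_eq_neg_one (eq_neg_of_add_eq_zero_left hi)
      have hodd := hp.eq_one_or_self_of_dvd 2
      omega
    -- the reduced curve is elliptic and its 2-torsion cubic splits
    set E : WeierstrassCurve (ZMod p) := M.map (Int.castRingHom (ZMod p)) with hE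
    haveI : E.IsElliptic := by
      rw [isElliptic_iff, hE, map_Δ, isUnit_iff_ne_zero, eq_intCast]
      exact hpΔ
    have hEs : E.twoTorsionPolynomial.toPoly.Splits := by
      rw [hE, map_twoTorsionPolynomial, Cubic.map_toPoly, ← hc]
      exact hcs
    have h4N : 4 ∣ Nat.card E.toAffine.Point := four_dvd_natCard_point_of_splits E hp2 hEs
    have hNle : Nat.card E.toAffine.Point ≤ 2 * p + 1 := by
      simpa [ZMod.card] using natCard_point_le_two_mul_card E
    have hNpos : 0 < reductionPointCount W p := reductionPointCount_pos W p
    have hN : reductionPointCount W p = Nat.card E.toAffine.Point := rfl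
    rw [frobeniusTrace, hN]
    set N := Nat.card E.toAffine.Point with hNdef
    rw [hN] at hNpos
    rintro ⟨k, hk⟩
    -- `N = p (1 - k) + 1` with `0 ≤ 1 - k ≤ 2`
    have hp0 : (0 : ℤ) < p := by exact_mod_cast hp.pos
    have hj0 : 0 ≤ 1 - k := by nlinarith
    have hj2 : 1 - k ≤ 2 := by nlinarith
    have hNk : (N : ℤ) = p * (1 - k) + 1 := by linarith
    obtain ⟨j, hj⟩ : ∃ j : ℤ, j = 1 - k := ⟨_, rfl⟩
    rw [← hj] at hj0 hj2 hNk
    interval_cases j <;> omega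

/-- **Discharge of `WeierstrassCurve.infinite_goodOrdinaryPrimes`.** Every elliptic curve over `ℚ`
(given by a globally minimal Weierstrass equation) has infinitely many primes `p` of good reduction
with `p ∤ a_p`, i.e. infinitely many good ordinary primes. Elementary proof (see the module
docstring): by the poor man's Chebotarev theorem there are arbitrarily large primes modulo which
`c · (X² + 1)` splits, and each such prime beyond `4 + |Δ_M|` is good ordinary
(`mem_goodOrdinaryPrimes_of_splits`). The cited source proves the much stronger density statement
(non-CM: supersingular primes have density `0`; CM: Deuring 1941, density `1/2`).
[cite: Serre1981, §8.2 Thm. 20 and Cor. 2 (p. 189); Deuring 1941 for CM] -/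
theorem infinite_goodOrdinaryPrimes_holds : infinite_goodOrdinaryPrimes := by
  intro W _ _
  refine Set.infinite_of_forall_exists_gt fun n => ?_
  have hc0 : (integralModelInt W).twoTorsionPolynomial.toPoly ≠ 0 :=
    Cubic.ne_zero_of_a_ne_zero (by norm_num [twoTorsionPolynomial])
  have hF0 : (integralModelInt W).twoTorsionPolynomial.toPoly * (X ^ 2 + 1) ≠ 0 :=
    mul_ne_zero hc0 (Polynomial.monic_X_pow_add_C 1 two_ne_zero).ne_zero
  obtain ⟨p, hp, hNp, hsplit⟩ :=
    Literature.NumberTheory.Sieve.exists_prime_gt_map_int_splits_holds _ hF0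
      (n + 4 + (integralModelInt W).Δ.natAbs)
  exact ⟨p, mem_goodOrdinaryPrimes_of_splits W hp (by omega) hsplit, by omega⟩

end WeierstrassCurve

end
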